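import Summits.BirchSwinnertonDyer.BirchSwinnertonDyer.Theorems.ByReductionTypeAtTwoSupersingularFlatLevelCongruence
import Summits.BirchSwinnertonDyer.BirchSwinnertonDyer.Theorems.ByReductionTypeAtTwoSupersingularFlatLevelIdentity
import Summits.BirchSwinnertonDyer.BirchSwinnertonDyer.Theorems.ByReductionTypeAtTwoSupersingularFlatHondaLogBaseCases
import Summits.BirchSwinnertonDyer.BirchSwinnertonDyer.Theorems.ByReductionTypeAtTwoSupersingularFlatTrivialCharBricks
import Summits.BirchSwinnertonDyer.BirchSwinnertonDyer.Theorems.ThetaPartnerAtTwoSignedKatoUpToAtTwoKatoBKSocketHelpers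
import HarnessLib

/-!
# Crux `SupersingularRankZeroAtTwo` (K4, item stmt-BirchSwinnertonDyer-19097), line `odd_blind_package` v2.19, `stub_flatPackage`
# conjunct (8), F3 — FILE E4: THE PER-LEVEL SOCKET for the Sprung–Honda system at `2` — the per-character identity
# «`ν(χ(5)−1)·∑_{j<2ⁿ} V_j χ(5)ʲ = μ(χ(5)−1)·RTSS f χ`» (primitive `χ`, or `n ≤ 1`) from the DISPLAYED (C6)-shaped pairing values, Kato's
# value law and the cusp multiplier — the log inputs (E1b/E1c) and Hecke inputs (E2c) DISCHARGED BY NAME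

Seat `bsd-2adic-tower-1` GEN 69, hand «hF3-ERL» (pen GEN 41 SUMMON 20260831T215831Z, director-bsd (979) slot 2). HONEST FRAMING:
theorems only (no definition, no named fact, no instance, no `sorry`); the published inputs (Kato's zeta values in the (C6)/Bloch–Kato
currency `hV`, Kato's value law `hB2`, the trivial-character value `hB4c`, the cusp multiplier `hμt`) are DISPLAYED hypotheses exactly as in
K3's socket `KatoBK.corePairChiPrim_of_coreKBK_of_bricks`; helper toward conjunct (8) F3 of `stub_flatPackage`; closes no stub and no item;
19097 OPEN; BSD₂ is proved for no supersingular curve and BSD for no curve by any of this.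

## What

For the displayed Sprung–Honda data on the `2`-adic model (FILE E0/E0b: `x 0 = 1`, `2x_1 = a`, `2x_2 = a x_1 − x_0`, `(N:ℤ) = 3 − a`, tower
points `y_m` with `Λ(T⁻¹ y_m) = ℓ_m(x)`, stabilisers, inverters `σ_m`, `d₀ n = N•(y_{n+2} + σ•y_{n+2}) − 2•y_1 ∈ E(ℚ_{2,n})`), a rational
newform `f` of odd level with `a₂(f) = a`, the level `n`, a local variable `g₀` (`g₀ʲ ζ_{2^{n+2}} = ζ^{5ʲ}`), Kato's embedding `e` and Galois
family `τ`, values `V j ∈ ℤ₂` with the (C6) shape `ι(V j) = ∑_b τ_b•(Λ(T⁻¹(g₀ʲ•d₀ n))·e(x_F))`, Kato's value law `hB2` (primitive `ψ_F`), the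
trivial-character value `hB4c` (`n ≤ 1`, depletion `(3−a)/2`), and a cusp multiplier `μ̃` with `μ̃(χ(5)−1) = D·R(χ)`:
★ `flat_charValue_of_C6` — for every even `2`-power-order `χ` modulo `2^{n+2}` that is PRIMITIVE or has `n ≤ 1`,
`C(D q.den)(χ(5)−1) · ∑_{j<2ⁿ} ι(V j) χ(5)ʲ = (C(N q.num)·μ̃)(χ(5)−1) · ratTwistedSymbolSum f χ`.
Proof: primitive `χ` — `SSFlatERL.flat_level_identity_primitive` with `L j := Λ(T⁻¹(g₀ʲ•d₀ n))` (`KatoBK.ptLogΩ_toLoc_symm_pow_smul`,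
`ptLogΩ_mem_layer`, `tau_neg_smul_ptLogΩ_eq`) and `hlogprim` := E1b ★★ `sum_pow_mul_ptLogΩ_pow_smul_flatHondaPoint_eq` (`u = N`); `n ≤ 1`
non-primitive — `χ = 1` (`KatoBK.eq_one_of_even_of_not_isPrimitive`), `flat_level_identity_trivial` with `hlog` := E1c, `hH` := E2c
`heckeBaseTwo_brick_of_cuspCoeff`, `hB4c`; then `SSFlatERL.charValue_of_levelIdentity`. This is the `hprim` input of FILE E3's
`forall_char_of_evalOn_of_primitive_or_le_one` for THE system (after the transport `c n = Φ(d₀ n)`, `Φ(g₀ʲ•P) = gʲ•Φ(P)` of E0b /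
`LocalVar.exists_localVariable_two`, with `V j := w(gʲ • c n)`).

References: [Kato2004Asterisque] Thm. 6.6 (1), Thm. 9.7, Thm. 12.5 (1); [Kobayashi2003] (8.23), Prop. 8.25–8.26, proof of Thm. 6.3 (p. 25);
[Sprung2012] Thm. 2.2, Lemma 2.3, Props. 6.3–6.5; [MazurTateTeitelbaum1986Invent] §I.4 (4.2), §I.13; [BlochKato1990] §3 (3.10.1), (3.11.1).
-/

set_option autoImplicit false
-- the Theorems namespace of this sub repeats the summit name by design (D-0017 nested layout)
set_option linter.dupNamespace false

noncomputable section

set_option backward.isDefEq.respectTransparency false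

open scoped Classical MatrixGroups ModularForm NumberField

namespace Summit.BirchSwinnertonDyer.BirchSwinnertonDyer.Theorems.SSFlatERL

open CongruenceSubgroup WeierstrassCurve Field IsDedekindDomain NumberField
  Literature.NumberTheory.GaloisRepresentations
  Literature.NumberTheory.EllipticCurves Literature.NumberTheory.EllipticCurves.ModularForms
  Literature.NumberTheory.EllipticCurves.Rank1Residual
  Literature.NumberTheory.EllipticCurves.Kobayashi2003 Literature.NumberTheory.EllipticCurves.Kato2004
  Literature.NumberTheory.EllipticCurves.Kato2004.EulerSystemValues
  Literature.NumberTheory.EllipticCurves.FormalGroupChart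
  ZpExtension
  Summit.BirchSwinnertonDyer.Rank1Residual.Additive Summit.BirchSwinnertonDyer.Rank1Residual.Additive.PadicCyclotomicTower
  Summit.BirchSwinnertonDyer.Rank1Residual.Additive.BallEval
  Summit.BirchSwinnertonDyer.BirchSwinnertonDyer.Theorems.SignedKatoOffTwo.LocalTwo
  Summit.BirchSwinnertonDyer.BirchSwinnertonDyer.Theorems.SignedKatoOffTwo
  Summit.BirchSwinnertonDyer.BirchSwinnertonDyer.Theorems.SignedKatoOffTwo.KatoBK

/-- **The per-level socket for THE Sprung–Honda system at `2`.** See the module docstring: from the displayed Sprung–Honda data on the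
model, the (C6)-shaped pairing values `hV`, Kato's value law `hB2`, the trivial-character value `hB4c` (`n ≤ 1`) and the cusp multiplier
`hμt`, the identity `C(D·q.den)(χ(5)−1) · ∑_{j<2ⁿ} ι(V j) χ(5)ʲ = (C(N·q.num)·μ̃)(χ(5)−1) · ratTwistedSymbolSum f χ` for every even
`2`-power-order `χ` mod `2^{n+2}` which is primitive or has `n ≤ 1` — FILE E3's `hprim` for THE system.
[cite: Kato2004Asterisque, Thm. 12.5 (1), Thm. 6.6 (1)] [cite: Kobayashi2003, Prop. 8.25–8.26, proof of Thm. 6.3 (p. 25)] [cite: Sprung2012, Props. 6.3–6.5] -/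
theorem flat_charValue_of_C6 (W : WeierstrassCurve ℚ) [W.IsElliptic] [W.IsGloballyMinimal]
    {κ : ZpExtension ℚ 2} (hκ : κ.IsCyclotomic) (ι : AlgebraicClosure ℚ →ₐ[ℚ] AlgebraicClosure ℚ_[2])
    {x : ℕ → ℚ_[2]} {y : ℕ → localPoints W ℚ_[2]} {σ : ℕ → Field.absoluteGaloisGroup ℚ_[2]} {d₀ : ℕ → localPoints W ℚ_[2]}
    {N : ℕ} {a : ℤ} (hx0 : x 0 = 1) (hx1 : (2 : ℚ_[2]) * x 1 = a) (hx2 : (2 : ℚ_[2]) * x 2 = a * x 1 - x 0) (hN : (N : ℤ) = 3 - a)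
    (hyΩ : haveI := isIntegral_genFib_baseChange 2 ((integralModelInt W).map (Int.castRingHom ℤ_[2]))
        ∀ m, (toLoc ((genFibΩ_eq_baseChange ((integralModelInt W).map (Int.castRingHom ℤ_[2]))).trans
              (baseChange_twoAdicModel W))).symm (y m) ∈
            subfieldPoints (genFibΩ 2 ((integralModelInt W).map (Int.castRingHom ℤ_[2]))) (layer 2 m).toSubfield
              coeffs_mem_layer ∧
          (toLoc ((genFibΩ_eq_baseChange ((integralModelInt W).map (Int.castRingHom ℤ_[2]))).trans
              (baseChange_twoAdicModel W))).symm (y m) ∈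
            kernel (Valued.v (R := PadicAlgCl 2)) (genFibΩ 2 ((integralModelInt W).map (Int.castRingHom ℤ_[2]))) ∧
          ptLogΩ 2 ((integralModelInt W).map (Int.castRingHom ℤ_[2]))
            ((toLoc ((genFibΩ_eq_baseChange ((integralModelInt W).map (Int.castRingHom ℤ_[2]))).trans
              (baseChange_twoAdicModel W))).symm (y m)) =
            ∑ k ∈ Finset.range m, algebraMap ℚ_[2] (PadicAlgCl 2) (x k) * (zeta 2 (m - k) - 1))
    (hystab : ∀ m, ∀ τ ∈ stab 2 m, τ • y m = y m)
    (hσ : ∀ m, 1 ≤ m → σ m • zeta 2 m = (zeta 2 m)⁻¹)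
    (hd₀ : ∀ n, d₀ n = N • (y (n + 2) + σ (n + 2) • y (n + 2)) - 2 • y 1)
    (hL₀ : ∀ m, d₀ m ∈ localLayerPointsOfEmb κ ι W m)
    -- the level, the local variable, Kato's embedding and Galois family
    (n : ℕ) {g₀ : Field.absoluteGaloisGroup ℚ_[2]} (hg₀ : ∀ j : ℕ, g₀ ^ j • zeta 2 (n + 2) = zeta 2 (n + 2) ^ 5 ^ j)
    (e : CyclotomicField (2 ^ (n + 2)) ℚ →ₐ[ℚ] PadicAlgCl 2)
    (he : e (IsCyclotomicExtension.zeta (2 ^ (n + 2)) ℚ (CyclotomicField (2 ^ (n + 2)) ℚ)) = zeta 2 (n + 2))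
    (τ : ZMod (2 ^ (n + 2)) → Field.absoluteGaloisGroup ℚ_[2])
    (hτ : ∀ b : ZMod (2 ^ (n + 2)), IsUnit b → τ b • zeta 2 (n + 2) = zeta 2 (n + 2) ^ b.val)
    -- (C6)-shaped pairing values
    (V : ℕ → ℤ_[2]) (xF : CyclotomicField (2 ^ (n + 2)) ℚ)
    (hV : haveI := isIntegral_genFib_baseChange 2 ((integralModelInt W).map (Int.castRingHom ℤ_[2]))
      ∀ j : ℕ, algebraMap ℚ_[2] (PadicAlgCl 2) (V j : ℚ_[2]) =
        ∑ b : (ZMod (2 ^ (n + 2)))ˣ, τ (b : ZMod (2 ^ (n + 2))) •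
          (ptLogΩ 2 ((integralModelInt W).map (Int.castRingHom ℤ_[2]))
            ((toLoc ((genFibΩ_eq_baseChange ((integralModelInt W).map (Int.castRingHom ℤ_[2]))).trans
              (baseChange_twoAdicModel W))).symm (g₀ ^ j • d₀ n)) * e xF))
    -- the newform, Kato's value law, the trivial-character value, the cusp multiplier
    {M : ℕ} [NeZero M] (f : CuspForm (Gamma0 M) 2) (hf0 : IsNewform0 f) (hQ : coeffField f = ⊥) (h2M : ¬ 2 ∣ M)
    (ha : cuspCoeff f 2 = (a : ℂ))
    (q : ℚ) (c d : ℤ) (hcu : IsUnit (c : ZMod (2 ^ (n + 2)))) (hdu : IsUnit (d : ZMod (2 ^ (n + 2)))) (S₁ S₂ S₃ S₄ : ℚ)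
    (hB2 : ∀ ψF : DirichletCharacter (CyclotomicField (2 ^ (n + 2)) ℚ) (2 ^ (n + 2)), ψF (-1) = 1 → ψF.IsPrimitive →
      (∑ b : (ZMod (2 ^ (n + 2)))ˣ, ψF⁻¹ (b : ZMod (2 ^ (n + 2))) * sigma (2 ^ (n + 2)) b xF) *
          gaussSum ψF (AddChar.zmodChar (2 ^ (n + 2))
            (IsCyclotomicExtension.zeta_pow (2 ^ (n + 2)) ℚ (CyclotomicField (2 ^ (n + 2)) ℚ))) =
        (q : CyclotomicField (2 ^ (n + 2)) ℚ) * ratTwistedSymbolSum f ψF *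
          ((c : CyclotomicField (2 ^ (n + 2)) ℚ) ^ 2 * (d : CyclotomicField (2 ^ (n + 2)) ℚ) ^ 2 * (S₁ : CyclotomicField (2 ^ (n + 2)) ℚ)
            - (c : CyclotomicField (2 ^ (n + 2)) ℚ) * (d : CyclotomicField (2 ^ (n + 2)) ℚ) ^ 2 * ψF (c : ZMod (2 ^ (n + 2))) *
              (S₂ : CyclotomicField (2 ^ (n + 2)) ℚ)
            - (c : CyclotomicField (2 ^ (n + 2)) ℚ) ^ 2 * (d : CyclotomicField (2 ^ (n + 2)) ℚ) * ψF (d : ZMod (2 ^ (n + 2))) *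
              (S₃ : CyclotomicField (2 ^ (n + 2)) ℚ)
            + (c : CyclotomicField (2 ^ (n + 2)) ℚ) * (d : CyclotomicField (2 ^ (n + 2)) ℚ) *
              (ψF (c : ZMod (2 ^ (n + 2))) * ψF (d : ZMod (2 ^ (n + 2)))) * (S₄ : CyclotomicField (2 ^ (n + 2)) ℚ)))
    (hB4c : n ≤ 1 → ∑ b : (ZMod (2 ^ (n + 2)))ˣ, sigma (2 ^ (n + 2)) b xF =
      (((3 - (a : ℚ)) / 2 * q * ratPlusSymbol f 0 * (c ^ 2 * d ^ 2 * S₁ - c * d ^ 2 * S₂ - c ^ 2 * d * S₃ + c * d * S₄) : ℚ) :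
        CyclotomicField (2 ^ (n + 2)) ℚ))
    (D : ℤ) (μt : IwasawaAlgebra 2)
    (hμt : ∀ χ : DirichletCharacter ℂ_[2] (2 ^ (n + 2)), χ.Even → (∃ j : ℕ, orderOf χ = 2 ^ j) →
      HasSum (fun k ↦ ((algebraMap ℚ_[2] ℂ_[2]).comp (algebraMap ℤ_[2] ℚ_[2])) (PowerSeries.coeff k μt) *
          (χ (5 : ZMod (2 ^ (n + 2))) - 1) ^ k)
        ((D : ℂ_[2]) * ((c : ℂ_[2]) ^ 2 * (d : ℂ_[2]) ^ 2 * (S₁ : ℂ_[2]) - (c : ℂ_[2]) * (d : ℂ_[2]) ^ 2 * χ (c : ZMod (2 ^ (n + 2))) * (S₂ : ℂ_[2])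
          - (c : ℂ_[2]) ^ 2 * (d : ℂ_[2]) * χ (d : ZMod (2 ^ (n + 2))) * (S₃ : ℂ_[2])
          + (c : ℂ_[2]) * (d : ℂ_[2]) * (χ (c : ZMod (2 ^ (n + 2))) * χ (d : ZMod (2 ^ (n + 2)))) * (S₄ : ℂ_[2]))))
    (χ : DirichletCharacter ℂ_[2] (2 ^ (n + 2))) (heven : χ.Even) (hord : ∃ j : ℕ, orderOf χ = 2 ^ j)
    (hprim' : χ.IsPrimitive ∨ n ≤ 1) :
    (∑' k, ((algebraMap ℚ_[2] ℂ_[2]).comp (algebraMap ℤ_[2] ℚ_[2]))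
          (PowerSeries.coeff k (PowerSeries.C (((D * q.den : ℤ) : ℤ_[2])))) * (χ (5 : ZMod (2 ^ (n + 2))) - 1) ^ k) *
      (∑ j ∈ Finset.range (2 ^ n), ((algebraMap ℚ_[2] ℂ_[2]).comp (algebraMap ℤ_[2] ℚ_[2])) (V j) *
        χ (5 : ZMod (2 ^ (n + 2))) ^ j) =
    (∑' k, ((algebraMap ℚ_[2] ℂ_[2]).comp (algebraMap ℤ_[2] ℚ_[2]))
          (PowerSeries.coeff k (PowerSeries.C ((((N : ℤ) * q.num : ℤ) : ℤ_[2])) * μt)) * (χ (5 : ZMod (2 ^ (n + 2))) - 1) ^ k) *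
      ratTwistedSymbolSum f χ := by
  haveI : NeZero (2 ^ (n + 2)) := ⟨pow_ne_zero _ two_ne_zero⟩
  haveI : NeZero (2 ^ n) := ⟨pow_ne_zero _ two_ne_zero⟩
  haveI hintΩ := isIntegral_genFib_baseChange 2 ((integralModelInt W).map (Int.castRingHom ℤ_[2]))
  -- the logarithms `L j = Λ(T⁻¹(g₀ʲ • d₀ n))` and their bookkeeping
  have hk0 : (toLoc ((genFibΩ_eq_baseChange ((integralModelInt W).map (Int.castRingHom ℤ_[2]))).trans
      (baseChange_twoAdicModel W))).symm (d₀ n) ∈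
        kernel (Valued.v (R := PadicAlgCl 2)) (genFibΩ 2 ((integralModelInt W).map (Int.castRingHom ℤ_[2]))) := by
    set hVm := (genFibΩ_eq_baseChange ((integralModelInt W).map (Int.castRingHom ℤ_[2]))).trans (baseChange_twoAdicModel W)
    set K := kernel (Valued.v (R := PadicAlgCl 2)) (genFibΩ 2 ((integralModelInt W).map (Int.castRingHom ℤ_[2])))
    have h1 : (toLoc hVm).symm (y (n + 2)) ∈ K := (hyΩ (n + 2)).2.1
    have h2 : (toLoc hVm).symm (y 1) ∈ K := (hyΩ 1).2.1
    have h3 : (toLoc hVm).symm (σ (n + 2) • y (n + 2)) ∈ K := @toLoc_symm_smul_mem_kernel W _ (σ (n + 2)) (y (n + 2)) @h1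
    have h4 : N • ((toLoc hVm).symm (y (n + 2)) + (toLoc hVm).symm (σ (n + 2) • y (n + 2))) - 2 • (toLoc hVm).symm (y 1) ∈ K :=
      K.sub_mem (K.nsmul_mem (K.add_mem @h1 @h3) N) (K.nsmul_mem @h2 2)
    rw [hd₀ n, map_sub, map_nsmul, map_nsmul, map_add]
    exact @h4
  obtain ⟨L, hLdef⟩ : ∃ L : ℕ → PadicAlgCl 2, L = fun j ↦ ptLogΩ 2 ((integralModelInt W).map (Int.castRingHom ℤ_[2]))
      ((toLoc ((genFibΩ_eq_baseChange ((integralModelInt W).map (Int.castRingHom ℤ_[2]))).trans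
        (baseChange_twoAdicModel W))).symm (g₀ ^ j • d₀ n)) := ⟨_, rfl⟩
  have hLj : ∀ j, L j = g₀ ^ j • ptLogΩ 2 ((integralModelInt W).map (Int.castRingHom ℤ_[2]))
      ((toLoc ((genFibΩ_eq_baseChange ((integralModelInt W).map (Int.castRingHom ℤ_[2]))).trans
        (baseChange_twoAdicModel W))).symm (d₀ n)) := fun j ↦ by
    rw [hLdef]; exact ptLogΩ_toLoc_symm_pow_smul W g₀ j (d₀ n) @hk0
  have hL0 : L 0 = ptLogΩ 2 ((integralModelInt W).map (Int.castRingHom ℤ_[2]))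
      ((toLoc ((genFibΩ_eq_baseChange ((integralModelInt W).map (Int.castRingHom ℤ_[2]))).trans
        (baseChange_twoAdicModel W))).symm (d₀ n)) := by rw [hLj, pow_zero, one_smul]
  have hLorb : ∀ j, L j = g₀ ^ j • L 0 := fun j ↦ by rw [hLj j, hL0]
  have hL0mem : L 0 ∈ layer 2 (n + 2) := by
    rw [hL0]; exact ptLogΩ_mem_layer W ι hκ n (d₀ n) (hL₀ n) @hk0
  have hLneg : ∀ b : ZMod (2 ^ (n + 2)), IsUnit b → τ (-b) • L 0 = τ b • L 0 := by
    intro b hb; rw [hL0]; exact tau_neg_smul_ptLogΩ_eq W ι hκ n τ hτ hb (d₀ n) (hL₀ n) @hk0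
  have hg₀1 : g₀ • zeta 2 (n + 2) = zeta 2 (n + 2) ^ 5 := by simpa using hg₀ 1
  have hV' : ∀ j : ℕ, algebraMap ℚ_[2] (PadicAlgCl 2) (V j : ℚ_[2]) =
      ∑ b : (ZMod (2 ^ (n + 2)))ˣ, τ (b : ZMod (2 ^ (n + 2))) • (L j * e xF) := by
    intro j; rw [hLdef]; exact hV j
  -- the level identity in E2's currency
  have hmain : (q.den : ℂ_[2]) * ∑ j ∈ Finset.range (2 ^ n),
        algebraMap (PadicAlgCl 2) ℂ_[2] (algebraMap ℚ_[2] (PadicAlgCl 2) (V j : ℚ_[2])) * χ (5 : ZMod (2 ^ (n + 2))) ^ j =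
      ((((N : ℤ) : ℚ) : ℚ) : ℂ_[2]) * (q.num : ℂ_[2]) *
        ((c : ℂ_[2]) ^ 2 * (d : ℂ_[2]) ^ 2 * (S₁ : ℂ_[2]) - (c : ℂ_[2]) * (d : ℂ_[2]) ^ 2 * χ (c : ZMod (2 ^ (n + 2))) * (S₂ : ℂ_[2])
          - (c : ℂ_[2]) ^ 2 * (d : ℂ_[2]) * χ (d : ZMod (2 ^ (n + 2))) * (S₃ : ℂ_[2])
          + (c : ℂ_[2]) * (d : ℂ_[2]) * (χ (c : ZMod (2 ^ (n + 2))) * χ (d : ZMod (2 ^ (n + 2)))) * (S₄ : ℂ_[2])) *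
        ratTwistedSymbolSum f χ := by
    by_cases hp : χ.IsPrimitive
    · -- primitive `χ`: E2 primitive with the log character sum of E1b (`u = N`)
      have hlogprim : ∀ ψ : DirichletCharacter (PadicAlgCl 2) (2 ^ (n + 2)), ψ (-1) = 1 → ψ.IsPrimitive →
          ∑ j ∈ Finset.range (2 ^ n), ψ (5 : ZMod (2 ^ (n + 2))) ^ j * L j =
            ((((N : ℤ) : ℚ) : ℚ) : PadicAlgCl 2) *
              gaussSum ψ (AddChar.zmodChar (2 ^ (n + 2)) (HondaLog.zeta_pow_prime_pow_self (p := 2) (n + 2))) := by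
        intro ψ hev hψ
        rw [hLdef]
        have h := sum_pow_mul_ptLogΩ_pow_smul_flatHondaPoint_eq W hx0 hyΩ hystab hσ hd₀ n hg₀1 ψ hψ hev
        rw [h]
        push_cast
        ring
      exact flat_level_identity_primitive f n (M := 2 ^ (n + 2)) rfl e he τ hτ hg₀ L hLorb hL0mem hLneg xF V hV' q c d _ _ _ _ hB2
        (((N : ℤ) : ℚ)) hlogprim χ heven hp
    · -- `n ≤ 1`, `χ = 1`: E2 trivial with the base-case logs of E1c and the Hecke values of E2c
      have hn : n ≤ 1 := hprim'.resolve_left hp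
      have h1 : χ = 1 := eq_one_of_even_of_not_isPrimitive hn χ heven hp
      subst h1
      obtain ⟨hH0, hH1⟩ := heckeBaseTwo_brick_of_cuspCoeff f hf0 hQ h2M ha
      have hH : ratTwistedSymbolSum f (1 : DirichletCharacter ℂ_[2] (2 ^ (n + 2))) =
          (((if n = 0 then ((a : ℚ) ^ 2 - 2 * a - 1) else ((a : ℚ) ^ 3 - 2 * a ^ 2 - 3 * a + 4)) * ratPlusSymbol f 0 : ℚ) : ℂ_[2]) := by
        interval_cases n
        · rw [hH0]; push_cast; ring
        · rw [hH1]; push_cast; ring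
      have hlog : ∑ j ∈ Finset.range (2 ^ n), L j =
          ((if n = 0 then 2 * ((a : ℚ) ^ 2 - 2 * a - 1) else 2 * ((a : ℚ) ^ 3 - 2 * a ^ 2 - 3 * a + 4) : ℚ) : PadicAlgCl 2) := by
        rw [hLdef]
        interval_cases n
        · have h := sum_pow_mul_ptLogΩ_pow_smul_flatHondaPoint_eq_level_zero W hx0 hx1 hN hyΩ hσ hd₀ g₀
            (1 : DirichletCharacter (PadicAlgCl 2) (2 ^ (0 + 2)))
          have h5 : (1 : DirichletCharacter (PadicAlgCl 2) (2 ^ (0 + 2))) (5 : ZMod (2 ^ (0 + 2))) = 1 :=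
            MulChar.one_apply (by simpa only [pow_one] using isUnit_five_pow (0 + 2) 1)
          simp only [h5, one_pow, one_mul] at h
          rw [h]; push_cast; simp
        · have h := sum_pow_mul_ptLogΩ_pow_smul_flatHondaPoint_eq_one_level_one W hx0 hx1 hx2 hN hyΩ hσ hd₀ hg₀1
          have h5 : (1 : DirichletCharacter (PadicAlgCl 2) (2 ^ (1 + 2))) (5 : ZMod (2 ^ (1 + 2))) = 1 :=
            MulChar.one_apply (by simpa only [pow_one] using isUnit_five_pow (1 + 2) 1)
          simp only [h5, one_pow, one_mul] at h
          rw [h]; push_cast; simp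
      have hB4c' : ∑ b : (ZMod (2 ^ (n + 2)))ˣ, sigma (2 ^ (n + 2)) b xF =
          (((((N : ℤ) : ℚ)) / 2 * q * ratPlusSymbol f 0 * (c ^ 2 * d ^ 2 * S₁ - c * d ^ 2 * S₂ - c ^ 2 * d * S₃ + c * d * S₄) : ℚ) :
            CyclotomicField (2 ^ (n + 2)) ℚ) := by
        rw [hB4c hn, hN]; push_cast; ring
      refine flat_level_identity_trivial f n (M := 2 ^ (n + 2)) rfl e he τ hτ hg₀ L hLorb hL0mem hLneg xF V hV' q c d hcu hdu
        (ratPlusSymbol f 0) _ _ _ _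
        (if n = 0 then 2 * ((a : ℚ) ^ 2 - 2 * a - 1) else 2 * ((a : ℚ) ^ 3 - 2 * a ^ 2 - 3 * a + 4))
        (if n = 0 then ((a : ℚ) ^ 2 - 2 * a - 1) else ((a : ℚ) ^ 3 - 2 * a ^ 2 - 3 * a + 4)) (((N : ℤ) : ℚ))
        (by split_ifs <;> ring) hlog hB4c' hH
  -- the adapter
  have h := charValue_of_levelIdentity n χ hord V q ((N : ℤ)) D _ (ratTwistedSymbolSum f χ) μt hmain (hμt χ heven hord)
  exact h

end Summit.BirchSwinnertonDyer.BirchSwinnertonDyer.Theorems.SSFlatERL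

end
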